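import Summits.CriticalPhenomena.PercolationContinuityZ3.Theorems.PercNearOneGluingNoHeavyLowerTailSahiTransportJRData4

/-!
# `NoHeavyLowerTail` (crux stmt-CriticalPhenomena-4575), Sahi / Kahn positivity: parameter-free transport certificates on `2^4` — evaluation E

Support file (cell `prim-l12`, seat P3, gen 5; `--supports stmt-CriticalPhenomena-4575`).  Computational (`native_decide`): the digit test
`SahiTransportJR.checkTab 33 4 M (certTab4 M)` — structure of the table, every capacity row and all `14 196` transport rows `X ≤ Z` over the `168`
increasing bitmasks of `2^4`, each a `256`-digit base-`2^33` Kronecker-number test — passes for the 28 nontrivial increasing pattern events `M` of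
batch E (`batch4E`).  Six batches A–F cover the `163` events of `2^4` outside the `K₂,₂` orbit; with `…SahiTransportJRSound.sahiE_three_nonneg_of_checkTab`
each gives Kahn's Conjecture 5 / Sahi's `C₃` for that junta first slot, the other two increasing events arbitrary, every dimension. [this work]
-/

namespace Summit.CriticalPhenomena.PercolationContinuityZ3.Theorems.SahiTransportJR

/-- Batch E of certified pattern events of `2^4` (bitmasks over the `16` points). [this work] -/
def batch4E : List ℕ := [64512, 64640, 64648, 64672, 64704, 64712, 64716, 64736, 64744, 64748, 64752, 64760, 64764, 65024, 65152, 65160, 65184, 65192, 65194, 65216, 65224, 65228, 65248, 65256, 65258, 65260, 65262, 65264]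

/-- Every event of batch E passes the certificate check (kernel evaluation via `native_decide`). [this work] -/
theorem checkTab4_batchE : (batch4E.all fun M => checkTab 33 4 M (certTab4 M)) = true := by native_decide

/-- Pointwise form. [this work] -/
theorem checkTab4_of_mem_batchE {M : ℕ} (h : M ∈ batch4E) : checkTab 33 4 M (certTab4 M) = true :=
  List.all_eq_true.1 checkTab4_batchE M h

end Summit.CriticalPhenomena.PercolationContinuityZ3.Theorems.SahiTransportJR
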